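import Mathlib

/-!
# Cold-halo witness for `CornerNoDip` — part 1: the Fejér triangle as a pair count

Helper lemmas for `Negative/ColdHalo.lean` (crux stmt-AtomisticToContinuum-16009, route
`HoelderEscapeProfile`; refuter cdisprove seat, 2026-08-17).  The triangle
`tri n x = #{(a,b) ∈ [0,n)² : x = a - b} / n² = (n - |x|)₊/n²` is handled through an abstract
function `tri` pinned by the hypothesis `htri` (no definitions in the negative lane): mass `1`,
on-site value `1/n`, second moment `(n² - 1)/6`, evenness, finite support, and the cosine transform
`cos(ks)·((Σ_{a<n} cos ka)² + (Σ_{a<n} sin ka)²)/n² ∈ [0, 1]` of its shifts — a sum of two squares,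
so Bochner positivity needs no closed form.  Plus three elementary facts used by the main file:
`∫_{-π}^{π} cos(kx) dk = 2π[x = 0]`, and the squeeze `1 ≤ ν⌈1/√ν⌉₊² ≤ (1 + √ν)²` giving
`ν(⌈1/√ν⌉₊² - 1)/12 → 1/12`.
-/

noncomputable section

namespace Summit.AtomisticToContinuum.FouriersLaw.Theorems.CornerNoDip.Negative.ColdHalo

open Finset Real MeasureTheory Set Filter Topology

/-- `Σ_{a<n} a = n(n-1)/2` over `ℝ`. [folklore] -/
theorem sum_range_id_cast (n : ℕ) : ∑ a ∈ Finset.range n, (a : ℝ) = n * (n - 1) / 2 := by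
  induction n with
  | zero => simp
  | succ n ih => rw [Finset.sum_range_succ, ih]; push_cast; ring

/-- `Σ_{a<n} a² = n(n-1)(2n-1)/6` over `ℝ`. [folklore] -/
theorem sum_range_sq_cast (n : ℕ) :
    ∑ a ∈ Finset.range n, (a : ℝ) ^ 2 = n * (n - 1) * (2 * n - 1) / 6 := by
  induction n with
  | zero => simp
  | succ n ih => rw [Finset.sum_range_succ, ih]; push_cast; ring

/-- `Σ_{a,b<n} cos(ka - kb) = (Σ cos ka)² + (Σ sin ka)²` — the Fejér sum is a sum of two squares. [folklore] -/
theorem sum_cos_pair (n : ℕ) (k : ℝ) :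
    ∑ ab ∈ range n ×ˢ range n, Real.cos (k * ab.1 - k * ab.2) =
      (∑ a ∈ range n, Real.cos (k * a)) ^ 2 + (∑ a ∈ range n, Real.sin (k * a)) ^ 2 := by
  simp_rw [Real.cos_sub, Finset.sum_product, Finset.sum_add_distrib, ← Finset.mul_sum,
    ← Finset.sum_mul, sq]

/-- `Σ_{a,b<n} sin(ka - kb) = 0`. [folklore] -/
theorem sum_sin_pair (n : ℕ) (k : ℝ) :
    ∑ ab ∈ range n ×ˢ range n, Real.sin (k * ab.1 - k * ab.2) = 0 := by
  simp_rw [Real.sin_sub, Finset.sum_product, Finset.sum_sub_distrib, ← Finset.mul_sum,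
    ← Finset.sum_mul]
  ring

/-- Shifted pair sum: `Σ_{a,b<n} cos(k(a - b + s)) = cos(ks)·((Σ cos ka)² + (Σ sin ka)²)`. [folklore] -/
theorem sum_cos_pair_shift (n : ℕ) (k : ℝ) (s : ℤ) :
    ∑ ab ∈ range n ×ˢ range n, Real.cos (k * (((ab.1 : ℤ) - ab.2 + s : ℤ) : ℝ)) =
      Real.cos (k * s) * ((∑ a ∈ range n, Real.cos (k * a)) ^ 2 +
        (∑ a ∈ range n, Real.sin (k * a)) ^ 2) := by
  have h : ∀ ab : ℕ × ℕ, Real.cos (k * (((ab.1 : ℤ) - ab.2 + s : ℤ) : ℝ)) =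
      Real.cos (k * s) * Real.cos (k * ab.1 - k * ab.2) -
        Real.sin (k * s) * Real.sin (k * ab.1 - k * ab.2) := by
    intro ab
    push_cast
    rw [show k * ((ab.1:ℝ) - ab.2 + s) = (k * ab.1 - k * ab.2) + k * s by ring, Real.cos_add]
    ring
  simp_rw [h, Finset.sum_sub_distrib, ← Finset.mul_sum, sum_cos_pair, sum_sin_pair]
  ring

/-- `(Σ_{a<n} cos ka)² + (Σ_{a<n} sin ka)² ≤ n²` (Cauchy–Schwarz): the normalised Fejér transform is `≤ 1`. [folklore] -/
theorem sum_pair_sq_le (n : ℕ) (k : ℝ) :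
    (∑ a ∈ range n, Real.cos (k * a)) ^ 2 + (∑ a ∈ range n, Real.sin (k * a)) ^ 2 ≤ (n : ℝ) ^ 2 := by
  have h1 := sq_sum_le_card_mul_sum_sq (s := range n) (f := fun a : ℕ => Real.cos (k * a))
  have h2 := sq_sum_le_card_mul_sum_sq (s := range n) (f := fun a : ℕ => Real.sin (k * a))
  simp only [card_range] at h1 h2
  have h3 : ∑ a ∈ range n, Real.cos (k * a) ^ 2 + ∑ a ∈ range n, Real.sin (k * a) ^ 2 = n := by
    rw [← Finset.sum_add_distrib]
    simp [Real.cos_sq_add_sin_sq]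
  nlinarith [h1, h2, h3]

/-- `Σ_{a,b<n} (a - b + s)² = n²((n² - 1)/6 + s²)`: second moment of the shifted triangle. [folklore] -/
theorem sum_pair_sq_shift (n : ℕ) (s : ℤ) :
    ∑ ab ∈ range n ×ˢ range n, ((((ab.1 : ℤ) - ab.2 + s : ℤ) : ℝ)) ^ 2 =
      (n : ℝ) ^ 2 * (((n : ℝ) ^ 2 - 1) / 6 + (s : ℝ) ^ 2) := by
  push_cast
  rw [Finset.sum_product]
  have inner : ∀ a : ℕ, ∑ b ∈ range n, (((a : ℝ) - b + s)) ^ 2 =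
      n * ((a : ℝ) + s) ^ 2 - 2 * ((a : ℝ) + s) * (n * (n - 1) / 2) + n * (n - 1) * (2 * n - 1) / 6 := by
    intro a
    have e : ∀ b : ℕ, ((a : ℝ) - b + s) ^ 2 = ((a : ℝ) + s) ^ 2 - 2 * ((a : ℝ) + s) * b + (b : ℝ) ^ 2 := by
      intro b; ring
    simp_rw [e, Finset.sum_add_distrib, Finset.sum_sub_distrib, Finset.sum_const, card_range,
      ← Finset.mul_sum, sum_range_id_cast, sum_range_sq_cast, nsmul_eq_mul]
  simp_rw [inner, Finset.sum_add_distrib, Finset.sum_sub_distrib, Finset.sum_const, card_range,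
    nsmul_eq_mul]
  have e2 : ∀ a : ℕ, (n : ℝ) * ((a : ℝ) + s) ^ 2 = n * (a : ℝ) ^ 2 + (2 * n * s) * a + n * s ^ 2 := by
    intro a; ring
  have e3 : ∀ a : ℕ, 2 * ((a : ℝ) + s) * (n * (n - 1) / 2) = (n * (n - 1)) * (a : ℝ) + s * (n * (n - 1)) := by
    intro a; ring
  simp_rw [e2, e3, Finset.sum_add_distrib, Finset.sum_const, card_range, ← Finset.mul_sum,
    sum_range_id_cast, sum_range_sq_cast, nsmul_eq_mul]
  ring

/-- `∫_{-π}^{π} cos(kx) dk = 2π[x = 0]` for integer `x`. [folklore] -/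
theorem integral_cos_mul_int (x : ℤ) :
    ∫ k in (-Real.pi)..Real.pi, Real.cos (k * x) = if x = 0 then 2 * Real.pi else 0 := by
  split_ifs with hx
  · subst hx
    simp only [Int.cast_zero, mul_zero, Real.cos_zero, intervalIntegral.integral_const, smul_eq_mul,
      mul_one]
    ring
  · have hx' : (x : ℝ) ≠ 0 := by exact_mod_cast hx
    rw [intervalIntegral.integral_comp_mul_right (fun y => Real.cos y) hx', integral_cos]
    have h1 : Real.sin (Real.pi * x) = 0 := by
      rw [mul_comm]; exact_mod_cast Real.sin_int_mul_pi x
    simp [h1]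

/-- `1 ≤ ν·⌈1/√ν⌉₊²` for `ν > 0`. [folklore] -/
theorem one_le_mul_ceil_sq {ν : ℝ} (hν : 0 < ν) :
    1 ≤ ν * ((⌈(Real.sqrt ν)⁻¹⌉₊ : ℕ) : ℝ) ^ 2 := by
  have h1 : (Real.sqrt ν)⁻¹ ≤ (⌈(Real.sqrt ν)⁻¹⌉₊ : ℝ) := Nat.le_ceil _
  have h3 : ν * ((Real.sqrt ν)⁻¹) ^ 2 = 1 := by
    rw [inv_pow, Real.sq_sqrt hν.le]; field_simp
  calc (1:ℝ) = ν * ((Real.sqrt ν)⁻¹) ^ 2 := h3.symm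
    _ ≤ ν * ((⌈(Real.sqrt ν)⁻¹⌉₊ : ℕ) : ℝ) ^ 2 := by
      apply mul_le_mul_of_nonneg_left _ hν.le
      exact pow_le_pow_left₀ (by positivity) h1 2

/-- `ν·⌈1/√ν⌉₊² ≤ (1 + √ν)²` for `ν > 0`. [folklore] -/
theorem mul_ceil_sq_le {ν : ℝ} (hν : 0 < ν) :
    ν * ((⌈(Real.sqrt ν)⁻¹⌉₊ : ℕ) : ℝ) ^ 2 ≤ (1 + Real.sqrt ν) ^ 2 := by
  have hs : 0 < Real.sqrt ν := Real.sqrt_pos.mpr hν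
  have h1 : ((⌈(Real.sqrt ν)⁻¹⌉₊ : ℕ) : ℝ) < (Real.sqrt ν)⁻¹ + 1 := Nat.ceil_lt_add_one (by positivity)
  have h3 : ν * ((Real.sqrt ν)⁻¹ + 1) ^ 2 = (1 + Real.sqrt ν) ^ 2 := by
    have e : Real.sqrt ν * (Real.sqrt ν)⁻¹ = 1 := mul_inv_cancel₀ hs.ne'
    calc ν * ((Real.sqrt ν)⁻¹ + 1) ^ 2 = (Real.sqrt ν) ^ 2 * ((Real.sqrt ν)⁻¹ + 1) ^ 2 := by
          rw [Real.sq_sqrt hν.le]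
      _ = (Real.sqrt ν * (Real.sqrt ν)⁻¹ + Real.sqrt ν) ^ 2 := by ring
      _ = (1 + Real.sqrt ν) ^ 2 := by rw [e]
  calc ν * ((⌈(Real.sqrt ν)⁻¹⌉₊ : ℕ) : ℝ) ^ 2 ≤ ν * ((Real.sqrt ν)⁻¹ + 1) ^ 2 := by
        apply mul_le_mul_of_nonneg_left _ hν.le
        exact pow_le_pow_left₀ (by positivity) h1.le 2
    _ = (1 + Real.sqrt ν) ^ 2 := h3

/-- The Abel conductivity of the witness, `ν(⌈1/√ν⌉₊² − 1)/12`, tends to `1/12` as `ν ↓ 0`. [folklore] -/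
theorem tendsto_ceil_model :
    Tendsto (fun ν : ℝ => ν / 2 * (((((⌈(Real.sqrt ν)⁻¹⌉₊ : ℕ) : ℝ)) ^ 2 - 1) / 6 - 0))
      (𝓝[>] 0) (𝓝 (1 / 12)) := by
  have hl : Tendsto (fun ν : ℝ => (1 - ν) / 12) (𝓝[>] 0) (𝓝 (1 / 12)) := by
    have : Tendsto (fun ν : ℝ => (1 - ν) / 12) (𝓝 0) (𝓝 ((1 - 0) / 12)) :=
      ((continuous_const.sub continuous_id).div_const _).tendsto 0
    rw [sub_zero] at this
    exact this.mono_left nhdsWithin_le_nhds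
  have hu : Tendsto (fun ν : ℝ => ((1 + Real.sqrt ν) ^ 2 - ν) / 12) (𝓝[>] 0) (𝓝 (1 / 12)) := by
    have : Tendsto (fun ν : ℝ => ((1 + Real.sqrt ν) ^ 2 - ν) / 12) (𝓝 0)
        (𝓝 (((1 + Real.sqrt 0) ^ 2 - 0) / 12)) :=
      ((((continuous_const.add Real.continuous_sqrt).pow 2).sub continuous_id).div_const _).tendsto 0
    rw [Real.sqrt_zero, add_zero, one_pow, sub_zero] at this
    exact this.mono_left nhdsWithin_le_nhds
  refine tendsto_of_tendsto_of_tendsto_of_le_of_le' hl hu ?_ ?_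
  · filter_upwards [self_mem_nhdsWithin] with ν hν
    have := one_le_mul_ceil_sq (Set.mem_Ioi.mp hν)
    nlinarith
  · filter_upwards [self_mem_nhdsWithin] with ν hν
    have := mul_ceil_sq_le (Set.mem_Ioi.mp hν)
    nlinarith

section Witness

variable {tri : ℕ → ℤ → ℝ}
  (htri : ∀ (n : ℕ) (x : ℤ), tri n x =
    (((Finset.range n ×ˢ Finset.range n).filter
      (fun ab : ℕ × ℕ => x = (ab.1 : ℤ) - (ab.2 : ℤ))).card : ℝ) / (n : ℝ) ^ 2)

include htri

/-- The pair count as a double sum of indicators. [folklore] -/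
theorem tri_eq_sum (n : ℕ) (x : ℤ) :
    tri n x = (∑ ab ∈ Finset.range n ×ˢ Finset.range n,
      (if x = (ab.1 : ℤ) - (ab.2 : ℤ) then (1:ℝ) else 0)) / (n : ℝ) ^ 2 := by
  rw [htri, Finset.natCast_card_filter]

/-- Pairing a test sequence with the triangle: `Σ_x φ(x)·tri n x = n⁻² Σ_{a,b<n} φ(a - b)`. [folklore] -/
theorem tsum_mul_tri (n : ℕ) (φ : ℤ → ℝ) :
    ∑' x : ℤ, φ x * tri n x =
      (∑ ab ∈ Finset.range n ×ˢ Finset.range n, φ ((ab.1 : ℤ) - ab.2)) / (n : ℝ) ^ 2 := by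
  have h1 : ∀ x : ℤ, φ x * tri n x =
      ∑ ab ∈ Finset.range n ×ˢ Finset.range n,
        (if x = (ab.1 : ℤ) - (ab.2 : ℤ) then φ ((ab.1:ℤ) - ab.2) / (n:ℝ)^2 else 0) := by
    intro x
    rw [tri_eq_sum htri, Finset.sum_div, Finset.mul_sum]
    refine Finset.sum_congr rfl fun ab _ => ?_
    split_ifs with h
    · rw [h]; ring
    · simp
  simp_rw [h1]
  rw [Summable.tsum_finsetSum (fun ab _ => (hasSum_ite_eq _ _).summable), Finset.sum_div]
  refine Finset.sum_congr rfl fun ab _ => ?_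
  exact tsum_ite_eq _ _

/-- Same for the shifted triangle `tri n (· - s)`. [folklore] -/
theorem tsum_mul_tri_shift (n : ℕ) (φ : ℤ → ℝ) (s : ℤ) :
    ∑' x : ℤ, φ x * tri n (x - s) =
      (∑ ab ∈ Finset.range n ×ˢ Finset.range n, φ ((ab.1 : ℤ) - ab.2 + s)) / (n : ℝ) ^ 2 := by
  rw [← tsum_mul_tri htri n (fun y => φ (y + s))]
  rw [← (Equiv.addRight s).tsum_eq]
  simp

/-- The triangle is supported in `|x| < n`. [folklore] -/
theorem tri_eq_zero_of (n : ℕ) (x : ℤ) (h : (n : ℤ) ≤ x ∨ x ≤ -(n : ℤ)) : tri n x = 0 := by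
  rw [htri]
  have : ((Finset.range n ×ˢ Finset.range n).filter
      (fun ab : ℕ × ℕ => x = (ab.1 : ℤ) - (ab.2 : ℤ))).card = 0 := by
    rw [Finset.card_eq_zero, Finset.filter_eq_empty_iff]
    intro ab hab h'
    rw [Finset.mem_product, Finset.mem_range, Finset.mem_range] at hab
    omega
  rw [this]; simp

/-- Finite support: `x ↦ φ(x)·tri n (x - s)` is summable. [folklore] -/
theorem summable_mul_tri_shift (n : ℕ) (φ : ℤ → ℝ) (s : ℤ) :
    Summable (fun x : ℤ => φ x * tri n (x - s)) := by
  refine summable_of_ne_finset_zero (s := Finset.Ioo (s - n) (s + n)) (fun x hx => ?_)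
  rw [tri_eq_zero_of htri n (x - s) ?_, mul_zero]
  rw [Finset.mem_Ioo] at hx
  omega

/-- Finite support: `x ↦ φ(x)·tri n x` is summable. [folklore] -/
theorem summable_mul_tri (n : ℕ) (φ : ℤ → ℝ) :
    Summable (fun x : ℤ => φ x * tri n x) := by
  simpa using summable_mul_tri_shift htri n φ 0

/-- On-site value `tri n 0 = 1/n` (the diagonal pairs). [folklore] -/
theorem tri_zero (n : ℕ) (hn : 1 ≤ n) : tri n 0 = 1 / n := by
  rw [tri_eq_sum htri, Finset.sum_product]
  have hiff : ∀ a b : ℕ, ((0:ℤ) = (a:ℤ) - (b:ℤ)) ↔ a = b := by intro a b; omega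
  simp_rw [hiff, Finset.sum_ite_eq]
  rw [Finset.sum_congr rfl (fun a ha => if_pos ha), Finset.sum_const, card_range, nsmul_eq_mul, mul_one]
  have hn' : (n : ℝ) ≠ 0 := by exact_mod_cast (by omega : n ≠ 0)
  field_simp

/-- The triangle is even. [folklore] -/
theorem tri_neg (n : ℕ) (x : ℤ) : tri n (-x) = tri n x := by
  rw [tri_eq_sum htri, tri_eq_sum htri, Finset.sum_product, Finset.sum_product, Finset.sum_comm]
  congr 1
  refine Finset.sum_congr rfl fun a _ => Finset.sum_congr rfl fun b _ => ?_
  have : (-x = (b:ℤ) - (a:ℤ)) ↔ (x = (a:ℤ) - (b:ℤ)) := by omega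
  simp only [this]

/-- Mass `1` (there are `n²` pairs). [folklore] -/
theorem tsum_tri_shift (n : ℕ) (hn : 1 ≤ n) (s : ℤ) : ∑' x : ℤ, tri n (x - s) = 1 := by
  have h := tsum_mul_tri_shift htri n (fun _ => (1:ℝ)) s
  simp only [one_mul] at h
  rw [h, Finset.sum_const, Finset.card_product, card_range, nsmul_eq_mul, mul_one]
  have hn' : (n : ℝ) ≠ 0 := by exact_mod_cast (by omega : n ≠ 0)
  push_cast
  field_simp

/-- Second moment of the shifted triangle: `(n² - 1)/6 + s²`. [folklore] -/
theorem tsum_sq_mul_tri_shift (n : ℕ) (hn : 1 ≤ n) (s : ℤ) :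
    ∑' x : ℤ, (x : ℝ) ^ 2 * tri n (x - s) = ((n : ℝ) ^ 2 - 1) / 6 + (s : ℝ) ^ 2 := by
  rw [tsum_mul_tri_shift htri n (fun x : ℤ => (x : ℝ) ^ 2) s, sum_pair_sq_shift]
  have hn' : (n : ℝ) ≠ 0 := by exact_mod_cast (by omega : n ≠ 0)
  field_simp

/-- Cosine transform of the shifted triangle: `cos(ks)·Fejér_n(k)` with `Fejér_n = ((Σcos)² + (Σsin)²)/n²`. [folklore] -/
theorem tsum_cos_mul_tri_shift (n : ℕ) (k : ℝ) (s : ℤ) :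
    ∑' x : ℤ, Real.cos (k * x) * tri n (x - s) =
      Real.cos (k * s) * ((∑ a ∈ range n, Real.cos (k * a)) ^ 2 +
        (∑ a ∈ range n, Real.sin (k * a)) ^ 2) / (n : ℝ) ^ 2 := by
  rw [tsum_mul_tri_shift htri n (fun x : ℤ => Real.cos (k * x)) s, sum_cos_pair_shift]


/-- Mass `1`, shift written `x + s`. [folklore] -/
theorem tsum_tri_shift' (n : ℕ) (hn : 1 ≤ n) (s : ℤ) : ∑' x : ℤ, tri n (x + s) = 1 := by
  simpa only [sub_neg_eq_add] using tsum_tri_shift htri n hn (-s)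

/-- Second moment, shift written `x + s`. [folklore] -/
theorem tsum_sq_mul_tri_shift' (n : ℕ) (hn : 1 ≤ n) (s : ℤ) :
    ∑' x : ℤ, (x : ℝ) ^ 2 * tri n (x + s) = ((n : ℝ) ^ 2 - 1) / 6 + (s : ℝ) ^ 2 := by
  have h := tsum_sq_mul_tri_shift htri n hn (-s)
  simp only [sub_neg_eq_add, Int.cast_neg, neg_sq] at h
  simpa using h

/-- Cosine transform, shift written `x + s`. [folklore] -/
theorem tsum_cos_mul_tri_shift' (n : ℕ) (k : ℝ) (s : ℤ) :
    ∑' x : ℤ, Real.cos (k * x) * tri n (x + s) =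
      Real.cos (k * s) * ((∑ a ∈ range n, Real.cos (k * a)) ^ 2 +
        (∑ a ∈ range n, Real.sin (k * a)) ^ 2) / (n : ℝ) ^ 2 := by
  have h := tsum_cos_mul_tri_shift htri n k (-s)
  simp only [sub_neg_eq_add, Int.cast_neg, mul_neg, Real.cos_neg] at h
  exact h

/-- Summability, shift written `x + s`. [folklore] -/
theorem summable_mul_tri_shift' (n : ℕ) (φ : ℤ → ℝ) (s : ℤ) :
    Summable (fun x : ℤ => φ x * tri n (x + s)) := by
  simpa only [sub_neg_eq_add] using summable_mul_tri_shift htri n φ (-s)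

end Witness

end Summit.AtomisticToContinuum.FouriersLaw.Theorems.CornerNoDip.Negative.ColdHalo

end
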